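import Literature.AnabelianGeometry.EtaleTheta.LogDivisorModelConstantField
import Literature.AnabelianGeometry.EtaleTheta.Discharge.Sec3Def36iOfGaloisCovering
import Literature.AnabelianGeometry.EtaleTheta.Discharge.Sec3Prop34CnstOfRlfZWeak

/-!
# [EtTh] Prop. 3.4 (ii), naturality relative to `D^cnst`, at the constructed Def. 3.3 (iii) data:
# `Prop34Cnst₀` / `Prop34Cnst` over the connected coverings dominated by one universal combinatorial covering

S. Mochizuki, *The étale theta function …*, Publ. RIMS **45** (2009) [MochizukiEtTh2009], §3, p.72 (the functor
`D₀ → D^cnst = B(Spec K)⁰`), Prop. 3.4 (ii) p.74 ("NATURAL isomorphisms … `O_L^× ⥲ Ker(B₀(Y^log) → Φ₀^gp(Y^log))`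
… `L^× ⥲ F₀(Y^log)`"), and the step of the proof of Thm. 3.7 (iii), p.80: "`Aut(L/K)` acts faithfully on `O_L^×`"
[cite: MochizukiEtTh2009, Prop 3.4 p.74].

PROOF-ONLY companion (abc-iut cell, W6 seat d058, EtTh:Prop3.4 chain; 0 defs).  abc-iut-L2-t3 typed the `D^cnst`
naturality content of Prop. 3.4 (ii) as the hypothesis structures `DivisorMonoids.Prop34Cnst₀ dm cnst` (B₀-level)
and `RealifiedDivisorMonoids.Prop34Cnst T cnst` (`TemperedFrobenioidCnst.lean`).  At the Def. 3.3 (iii) data of the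
CONNECTED coverings dominated by `Z^log_∞` (`DivisorMonoids.ofGaloisActionConnected A hZ`) with the constant-field
functor `cnst := GaloisAction.cnstFunctor A` (`Y ↦ N∖Y`, `N = Ker(G → Aut(L'^×))`, `LogDivisorModelConstantField.lean`):

* clause 1 — `B₀_map_eq_of_cnst_map_eq_ofGaloisActionConnected`: covering maps with the same image in `D^cnst`
  pull constants back identically (`L^× ⥲ F₀` is natural) — PROVED outright;
* clause 2 — `Φ₀_map_eq_of_cnst_map_eq_ofGaloisActionConnected`: … and pull the divisors of constants back
  identically — PROVED outright (divisor equivariance + `N` fixes constants);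
* clause 3 — `cnst_map_eq_of_B₀_map_eq_ofGaloisActionConnected`: automorphisms of a connected covering acting
  identically on `Ker(B₀ → Φ₀^gp) = Hom_G(Y, O^×)` have the same image in `Aut_{D^cnst}` — PROVED from the binder
  `GaloisAction.ConstGaloisLaw` (GAP G-w6d058-2: "an element fixing all `H`-invariant unit constants lies in `N·H`"),
  via `exists_bZero_of_stab_invariant` (an `H`-invariant unit constant extends to an equivariant family with
  trivial divisor);
* `prop34Cnst₀_ofGaloisActionConnected (hGC) : (ofGaloisActionConnected A hZ).Prop34Cnst₀ (cnstFunctor A)` and, via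
  abc-iut-L2-d2's transport `RealifiedDivisorMonoids.Prop34Cnst.ofRlfZWeak`, **`prop34Cnst_rlfZ_ofGaloisActionConnected
  (hGC)`**: `Prop34Cnst` at the type-`ℤ` realified data `ofRlfZWeakOfProp34 … (prop34_ofGaloisActionConnected …)` —
  so `TemperedFrobenioid.thm37_iii_withCnst_ofRlfZWeak` applies to every tempered Frobenioid over that data.
HONEST FRAMING: theorems about a construction over typed interfaces (one term of Def. 3.3 (iii)'s limit; binders
`hZ` = G-w6d058-1 and `hGC` = G-w6d058-2 named); nothing here bears on [IUTchIII] Cor. 3.12; no side taken; typed ≠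
proved for anything not stated here.
-/

noncomputable section

namespace Literature.AnabelianGeometry.EtaleTheta

open CategoryTheory Opposite Literature.AlgebraicGeometry.Frobenioids

universe u

namespace LogDivisorModel.GaloisAction

variable {Z : LogDivisorModel.{u}} {G : Type u} [Group G] (A : Z.GaloisAction G)

/-- `(g h) · s = g · (h · s)` (structure action of a `G`-set). [folklore] -/
private theorem ρ_mul_apply' (S : Action (Type u) G) (g h : G) (s : S.V) : S.ρ (g * h) s = S.ρ g (S.ρ h s) := by
  rw [map_mul]; rfl

/-- `1 · s = s`. [folklore] -/
private theorem ρ_one_apply' (S : Action (Type u) G) (s : S.V) : S.ρ (1 : G) s = s := by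
  rw [map_one]; rfl

/-- **An `H`-invariant unit integral constant extends to an equivariant family with trivial divisor** on a connected
covering with base point `t`, `H = Stab(t)`: there is `b ∈ B₀(S)` with `div₀ b = 1` and `b(a · t) = a · u`.
[cite: MochizukiEtTh2009, Prop 3.4 p.74] -/
theorem exists_bZero_of_stab_invariant (S : Action (Type u) G) (hS : isConnectedGSet S) (t : S.V) {u : Z.Fn}
    (hu : u ∈ Z.intConst) (hu' : u⁻¹ ∈ Z.intConst) (hinv : ∀ h : G, S.ρ h t = t → A.actFn h u = u) :
    ∃ b : A.bZero S, A.divZeroHom S b = 1 ∧ ∀ a : G, b.1 (S.ρ a t) = A.actFn a u := by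
  classical
  choose x hx using fun s : S.V => hS.2 t s
  -- the value `a · u` depends only on the point `a · t`
  have hwd : ∀ (a : G) (s : S.V), S.ρ a t = s → A.actFn a u = A.actFn (x s) u := by
    intro a s has
    have h0 : S.ρ (x s)⁻¹ s = t := by
      calc S.ρ (x s)⁻¹ s = S.ρ (x s)⁻¹ (S.ρ (x s) t) := by rw [hx s]
        _ = t := by rw [← ρ_mul_apply', inv_mul_cancel, ρ_one_apply']
    have h1 : S.ρ ((x s)⁻¹ * a) t = t := by rw [ρ_mul_apply', has, h0]
    have h2 := hinv _ h1
    calc A.actFn a u = A.actFn (x s) (A.actFn ((x s)⁻¹ * a) u) := by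
          rw [← MulAut.mul_apply, ← map_mul, mul_inv_cancel_left]
      _ = A.actFn (x s) u := by rw [h2]
  have hmero : ∀ s, A.actFn (x s) u ∈ Z.logMero := fun s =>
    A.act_mem_logMero _ (Z.const_le_logMero (Z.intConst_le_const hu))
  refine ⟨⟨fun s => A.actFn (x s) u, hmero, fun g s => ?_⟩, ?_, fun a => ?_⟩
  · show A.actFn (x (S.ρ g s)) u = A.actFn g (A.actFn (x s) u)
    rw [← MulAut.mul_apply, ← map_mul]
    exact (hwd (g * x s) (S.ρ g s) (by rw [ρ_mul_apply', hx])).symm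
  · rw [divZeroHom_eq_one_iff]
    intro s
    exact ⟨A.act_mem_intConst _ hu, by
      show (A.actFn (x s) u)⁻¹ ∈ Z.intConst
      rw [← map_inv]; exact A.act_mem_intConst _ hu'⟩
  · show A.actFn (x (S.ρ a t)) u = A.actFn a u
    exact (hwd a _ rfl).symm

end LogDivisorModel.GaloisAction

namespace DivisorMonoids

open LogDivisorModel.GaloisAction

variable {Z : LogDivisorModel.{u}} {G : Type u} [Group G] (A : Z.GaloisAction G) (hZ : Z.CuspLaws)

/-- **Clause 1 of `Prop34Cnst₀` at the connected constructed data** (naturality of `L^× ⥲ F₀` w.r.t. `D^cnst`):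
covering maps with the same image in `D^cnst` pull the constant families back identically.  Outright.
[cite: MochizukiEtTh2009, Prop 3.4 p.74] -/
theorem B₀_map_eq_of_cnst_map_eq_ofGaloisActionConnected {Y Y' : (isConnectedGSet (G := G)).FullSubcategory}
    (g g' : Y ⟶ Y') (hg : A.cnstFunctor.map g = A.cnstFunctor.map g')
    (b : (ofGaloisActionConnected A hZ).B₀.obj (op Y')) (hb : b ∈ (ofGaloisActionConnected A hZ).F₀ (op Y')) :
    ((ofGaloisActionConnected A hZ).B₀.map g.op).hom b = ((ofGaloisActionConnected A hZ).B₀.map g'.op).hom b := by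
  rw [cnstFunctor_map_eq_iff] at hg
  have hb' : ∀ t, b.1 t ∈ Z.const := hb
  change A.bZeroPull g.hom b = A.bZeroPull g'.hom b
  refine Subtype.ext (funext fun s => ?_)
  obtain ⟨n, hn, hns⟩ := hg s
  have e : b.1 (Y'.obj.ρ n (g.hom.hom s)) = A.actFn n (b.1 (g.hom.hom s)) := b.2.2 n _
  rw [bZeroPull_apply, bZeroPull_apply, ← hns, e]
  exact (hn _ (hb' _)).symm

/-- **Clause 2 of `Prop34Cnst₀` at the connected constructed data**: covering maps with the same image in `D^cnst`
pull the DIVISORS of constant families back identically (divisor equivariance; `N` fixes constants).  Outright.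
[cite: MochizukiEtTh2009, Prop 3.4 p.74] -/
theorem Φ₀_map_eq_of_cnst_map_eq_ofGaloisActionConnected {Y Y' : (isConnectedGSet (G := G)).FullSubcategory}
    (g g' : Y ⟶ Y') (hg : A.cnstFunctor.map g = A.cnstFunctor.map g')
    (x : (ofGaloisActionConnected A hZ).Φ₀.obj (op Y'))
    (hx : ∃ b ∈ (ofGaloisActionConnected A hZ).F₀ (op Y'),
      (ofGaloisActionConnected A hZ).div₀ (op Y') b = Algebra.GrothendieckGroup.of x) :
    ((ofGaloisActionConnected A hZ).Φ₀.map g.op).hom x = ((ofGaloisActionConnected A hZ).Φ₀.map g'.op).hom x := by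
  obtain ⟨b, hb, hbx⟩ := hx
  have hb' : ∀ t, b.1 t ∈ Z.const := hb
  have hdiv : ∀ t, A.divAt Y'.obj b t = x.1 t := (A.divZeroHom_eq_of_iff Y'.obj b x).1 hbx
  rw [cnstFunctor_map_eq_iff] at hg
  change A.phiZeroPull g.hom x = A.phiZeroPull g'.hom x
  refine Subtype.ext (funext fun s => ?_)
  obtain ⟨n, hn, hns⟩ := hg s
  have e : x.1 (Y'.obj.ρ n (g.hom.hom s)) = A.actDIV n (x.1 (g.hom.hom s)) := x.2.2 n _
  rw [phiZeroPull_apply, phiZeroPull_apply, ← hns, e, ← hdiv (g.hom.hom s), divAt,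
    ← A.divisor_act' n (b.2.1 _) (A.act_mem_logMero n (b.2.1 _))]
  congr 1
  exact Subtype.ext (hn _ (hb' _)).symm

/-- **Clause 3 of `Prop34Cnst₀` at the connected constructed data, from the Galois-correspondence binder**:
automorphisms of a connected covering acting identically on the families with trivial divisor
(`= Hom_G(Y, O^×)`) have the same image in `Aut_{D^cnst}` ("`Aut(L/K)` acts faithfully on `O_L^×`").
[cite: MochizukiEtTh2009, Thm 3.7 (iii) p.79] -/
theorem cnst_map_eq_of_B₀_map_eq_ofGaloisActionConnected (hGC : A.ConstGaloisLaw)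
    {Y : (isConnectedGSet (G := G)).FullSubcategory} (g g' : Y ≅ Y)
    (hker : ∀ b : (ofGaloisActionConnected A hZ).B₀.obj (op Y), (ofGaloisActionConnected A hZ).div₀ (op Y) b = 1 →
      ((ofGaloisActionConnected A hZ).B₀.map g.hom.op).hom b = ((ofGaloisActionConnected A hZ).B₀.map g'.hom.op).hom b) :
    A.cnstFunctor.map g.hom = A.cnstFunctor.map g'.hom := by
  rw [cnstFunctor_map_eq_iff]
  intro s
  obtain ⟨a, ha⟩ := Y.property.2 (g.hom.hom.hom s) (g'.hom.hom.hom s)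
  -- the stabiliser of the point `t := g s`
  let H : Subgroup G :=
    { carrier := {h | Y.obj.ρ h (g.hom.hom.hom s) = g.hom.hom.hom s}
      mul_mem' := fun {c d} hc hd => by
        show Y.obj.ρ (c * d) _ = _
        rw [map_mul]
        change Y.obj.ρ c (Y.obj.ρ d _) = _
        rw [hd, hc]
      one_mem' := by
        show Y.obj.ρ 1 _ = _
        rw [map_one]; rfl
      inv_mem' := fun {c} hc => by
        show Y.obj.ρ c⁻¹ _ = _
        conv_lhs => rw [← hc]
        change (Y.obj.ρ c⁻¹ * Y.obj.ρ c) _ = _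
        rw [← map_mul, inv_mul_cancel, map_one]; rfl }
  obtain ⟨n, hn, hnH⟩ := hGC.exists_mem_constInertia H a fun u hu hu' hinvH => by
    -- an `H`-invariant unit constant `u` is fixed by `a`
    obtain ⟨b, hb1, hbval⟩ :=
      A.exists_bZero_of_stab_invariant Y.obj Y.property (g.hom.hom.hom s) hu hu' fun h hh => hinvH h hh
    have hk := congrArg (fun c : A.bZero Y.obj => c.1 s) (hker b hb1)
    change b.1 (g.hom.hom.hom s) = b.1 (g'.hom.hom.hom s) at hk
    have e1 : b.1 (g.hom.hom.hom s) = u := by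
      have h := hbval 1
      rw [map_one, map_one, MulAut.one_apply] at h
      exact h
    rw [← ha, hbval a, e1] at hk
    exact hk.symm
  refine ⟨n, hn, ?_⟩
  have h1 : Y.obj.ρ (n⁻¹ * a) (g.hom.hom.hom s) = g.hom.hom.hom s := hnH
  rw [← ha]
  calc Y.obj.ρ n (g.hom.hom.hom s) = Y.obj.ρ n (Y.obj.ρ (n⁻¹ * a) (g.hom.hom.hom s)) := by rw [h1]
    _ = Y.obj.ρ a (g.hom.hom.hom s) := by
        change (Y.obj.ρ n * Y.obj.ρ (n⁻¹ * a)) _ = _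
        rw [← map_mul, mul_inv_cancel_left]

/-- **`Prop34Cnst₀` at the connected constructed data** (clauses 1–2 outright, clause 3 from the binder
`ConstGaloisLaw`, GAP G-w6d058-2). [cite: MochizukiEtTh2009, Prop 3.4 p.74] -/
theorem prop34Cnst₀_ofGaloisActionConnected (hGC : A.ConstGaloisLaw) :
    (ofGaloisActionConnected A hZ).Prop34Cnst₀ A.cnstFunctor where
  B₀_map_eq_of_cnst_map_eq g g' hg b hb := B₀_map_eq_of_cnst_map_eq_ofGaloisActionConnected A hZ g g' hg b hb
  Φ₀_map_eq_of_cnst_map_eq g g' hg x hx := Φ₀_map_eq_of_cnst_map_eq_ofGaloisActionConnected A hZ g g' hg x hx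
  cnst_map_eq_of_B₀_map_eq g g' h := cnst_map_eq_of_B₀_map_eq_ofGaloisActionConnected A hZ hGC g g' h

/-- **`Prop34Cnst` at the type-`ℤ` realified data over the connected constructed data** (abc-iut-L2-d2's transport
`Prop34Cnst.ofRlfZWeak` applied to `prop34_ofGaloisActionConnected` and `prop34Cnst₀_ofGaloisActionConnected`): every
Prop. 3.4 (ii) clause the Thm. 3.7 (iii) consumers read holds there, modulo the two named binders.
[cite: MochizukiEtTh2009, Prop 3.4 p.74] -/
theorem prop34Cnst_rlfZ_ofGaloisActionConnected (hGC : A.ConstGaloisLaw)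
    (R R' : ((isConnectedGSet (G := G)).FullSubcategoryᵒᵖ ⥤ CommMonCat.{u}) → Prop) :
    (RealifiedDivisorMonoids.ofRlfZWeakOfProp34 (ofGaloisActionConnected A hZ)
        (prop34_ofGaloisActionConnected A hZ R R')).Prop34Cnst A.cnstFunctor :=
  RealifiedDivisorMonoids.Prop34Cnst.ofRlfZWeak (prop34_ofGaloisActionConnected A hZ R R')
    (prop34Cnst₀_ofGaloisActionConnected A hZ hGC)

/-- **[EtTh] Thm. 3.7 (iii) for EVERY tempered Frobenioid over the constructed Def. 3.6 (i) type-`ℤ` data** of the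
connected coverings dominated by one universal combinatorial covering, at the facade instantiated with the
constant-field functor `cnstFunctor` — abc-iut-L2-d2's `thm37_iii_withCnst_ofRlfZWeak` with BOTH of its Def. 3.3
(iii)-level hypotheses (`Prop34`, `Prop34Cnst₀`) now THEOREMS at this data; residual = the binder `hGC`
(GAP G-w6d058-2) only.  (Append 2026-08-26, same seat; prefix byte-identical.) [cite: MochizukiEtTh2009, Thm 3.7 (iii) p.79] -/
theorem thm37_iii_rlfZ_ofGaloisActionConnected (hGC : A.ConstGaloisLaw)
    (R R' : ((isConnectedGSet (G := G)).FullSubcategoryᵒᵖ ⥤ CommMonCat.{u}) → Prop)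
    {D : Type u} [Category.{u} D] {VD : FrdICatStub.{u, u, u} D}
    (C₀ : TemperedFrobenioid (RealifiedDivisorMonoids.ofRlfZWeakOfProp34 (ofGaloisActionConnected A hZ)
      (prop34_ofGaloisActionConnected A hZ R R')) D VD)
    (F : FrobenioidFacade.{u, u, u} D) :
    TemperedFrobenioid.Thm37_iii
      (T := RealifiedDivisorMonoids.ofRlfZWeakOfProp34 (ofGaloisActionConnected A hZ)
        (prop34_ofGaloisActionConnected A hZ R R')) C₀ (F.withCnst (C₀.base ⋙ A.cnstFunctor)) :=
  TemperedFrobenioid.thm37_iii_withCnst_ofRlfZWeak C₀ F (prop34_ofGaloisActionConnected A hZ R R')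
    (prop34Cnst₀_ofGaloisActionConnected A hZ hGC)

end DivisorMonoids

end Literature.AnabelianGeometry.EtaleTheta

end
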